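import Summits.QuantumFields.BalabanUV.T4Continuum.Support.BlockPairingGeometry
import Literature.MathematicalPhysics.QuantumFieldTheory.Balaban1983to89.T4EtaRateMin

/-!
# T⁴ programme, spine node NE2 (U1a) — THE DAG EDGE NE2 ⇐ NE3: a background tower's two-level consistency IS node U1b's currency
# `T4EtaRateMin.LocalRate` (tier B, row B6 of `t4/SKELETON-NE2-P1.md`)

Ninth generation of the NE2 prover lineage P1 of the cell `pub-balaban`, file 20.  Every discharge of the typed residual
`PerturbationLaws` along the resolvent route (tier A: `FirstOrderBackgroundModel`, `PerturbationAlgebra`, `AbelianCovariantLaplacian`;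
tier B: `ColourCovariantLaplacian`) asks of the background data ONE thing that is not lattice-local regularity: the TWO-LEVEL
CONSISTENCY `‖W^{(k+1)}(x′) − W^{(k)}(parT x′)‖ ≤ β·L^{−k}` of the coefficient towers at adjacent spacings under the block-parent
pairing.  For Bałaban's background fields `U_k(V)` this is an η-RATE STATEMENT FOR THE MINIMISERS — exactly node U1b / NE3 of the
T⁴ DAG (XREAD U1b: not printed; typed in the tree as `T4EtaRateMin.LocalRate`).  This file makes the edge LITERAL:

 * §1 addresses: `pt x₀ r k` — the level-`k` site with base point `x₀` and block offsets `r 0, …, r (k−1)` (`par (pt (k+1)) = pt k`),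
   and `exists_pt` (every site has an address);
 * §2 **`bgReadings 𝒟`** — the `T4EtaRateMin.Readings` of a class `𝒟` of colour-matrix coefficient towers
   `W : (k : ℕ) → Fin d → idx L M k → Matrix o o ℂ`: the local reading at unit-scale site
   `s = (x₀, r, μ, ν, a, b, re/im)` of the `k`-step run is `Re/Im (W k ν (pt x₀ r k, μ) a b)`;
 * §3 **`consistent_of_localRate`**: `LocalRate (bgReadings 𝒟) C θ → ∀ W ∈ 𝒟, ‖W (k+1) ν x′ − W k ν (parT x′)‖ ≤ 2·(card o)·C·θ^k`
   (entrywise `≤ 2Cθ^k`), i.e. with `θ = L⁻¹` EXACTLY the `consistent` fields of `LipschitzBackground(M)` / `BoundedBackground(M)`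
   (`consistent_of_localRate_lev`: `≤ (2·card o·C)/L^k`); and the converse **`localRate_of_consistent`** — the adapter is faithful.
So ROOT B of the skeleton consumes NE3 BY NAME: its hypothesis is `LocalRate (bgReadings 𝒟_Bałaban) C L⁻¹` for the class of
coefficient towers of Bałaban's `U_k(V)`, `V` in the small-field region — NE3's own predicate, no `Prop` mirror.

HONEST FRAMING (T4-DAG p. 1).  Pure bookkeeping (block addresses, real/imaginary parts, entries vs operator norm); proves NOTHING
about Bałaban's minimisers; NE3 is OPEN (0/9); NOT infinite volume / mass gap / Clay / summit progress; spine 0/9 unchanged.  HONEST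
DEPENDENCY: continuum YM on T⁴ ⇐ BetaPertH ∧ nine spine estimates (0/9 proved); BetaPertH ⇐ (D1) ∧ (D4) ∧ CAP+tail; G-an2-4 gates
asym, D1 and NE2/3/4.  ABSOLUTE RULE kept; no `sorry`.
-/

noncomputable section

open scoped BigOperators ComplexConjugate Matrix Matrix.Norms.L2Operator

namespace Summit.QuantumFields.BalabanUV.T4Continuum.NE2FromNE3

open Literature.MathematicalPhysics.QuantumFieldTheory.Balaban1983to89.B5Prop11Plancherel (fine Tor)
open Literature.MathematicalPhysics.QuantumFieldTheory.Balaban1983to89.B5G183RateTorus (cpt)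
open Literature.MathematicalPhysics.QuantumFieldTheory.Balaban1983to89.B5G183RateTorusW (off)
open Literature.MathematicalPhysics.QuantumFieldTheory.Balaban1983to89.B5G183RateUnitTower (lev lev_neZero)
open Literature.MathematicalPhysics.QuantumFieldTheory.Balaban1983to89.B5G183RateOp (opNorm_le_of_schur)
open Literature.MathematicalPhysics.QuantumFieldTheory.Balaban1983to89.T4EtaRateMin (Readings LocalRate)
open Summit.QuantumFields.BalabanUV.T4Continuum
open Summit.QuantumFields.BalabanUV.T4Continuum.BalabanAveragedTowerModes (par rem par_cpt_add_off rem_cpt_add_off cpt_par_add_off_rem)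
open Summit.QuantumFields.BalabanUV.T4Continuum.BalabanAveragedTowerUnit (idx cast_lev' norm_entry_le_opNorm)
open Summit.QuantumFields.BalabanUV.T4Continuum.BlockPairingGeometry (parT)

variable {d : ℕ} (L : ℕ) [NeZero L] (M : Fin d → ℕ) [hM : ∀ μ, NeZero (M μ)]

/-! ## §1 Block addresses -/

/-- the level-`k` site with base point `x₀` and block offsets `r 0, …, r (k − 1)`. [cite: King1986, (2.10) p.653 («B^k(y)»)] [folklore] -/
def pt (x₀ : Tor (fine (lev L 0) M)) (r : ℕ → (Fin d → Fin L)) : (k : ℕ) → Tor (fine (lev L k) M)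
  | 0 => x₀
  | k + 1 => cpt (lev L k) L M (pt x₀ r k) + off (lev L k) L M (r k)

/-- the parent of an addressed site is the addressed site one level up. [folklore] -/
theorem par_pt_succ (x₀ : Tor (fine (lev L 0) M)) (r : ℕ → (Fin d → Fin L)) (k : ℕ) :
    par (lev L k) L M (pt L M x₀ r (k + 1)) = pt L M x₀ r k :=
  par_cpt_add_off (lev L k) L M _ _

omit [NeZero L] hM in
/-- addresses agreeing below `k` give the same level-`k` site. [folklore] -/
theorem pt_congr (x₀ : Tor (fine (lev L 0) M)) {r r' : ℕ → (Fin d → Fin L)} :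
    ∀ k, (∀ j < k, r j = r' j) → pt L M x₀ r k = pt L M x₀ r' k
  | 0, _ => rfl
  | k + 1, h => by
    show cpt (lev L k) L M (pt L M x₀ r k) + off (lev L k) L M (r k) = cpt (lev L k) L M (pt L M x₀ r' k) + off (lev L k) L M (r' k)
    rw [pt_congr x₀ k fun j hj => h j (Nat.lt_succ_of_lt hj), h k (Nat.lt_succ_self k)]

/-- every site has an address. [folklore] -/
theorem exists_pt : ∀ (k : ℕ) (x : Tor (fine (lev L k) M)), ∃ x₀ r, pt L M x₀ r k = x
  | 0, x => ⟨x, fun _ _ => 0, rfl⟩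
  | k + 1, x => by
    obtain ⟨x₀, r, h⟩ := exists_pt k (par (lev L k) L M x)
    refine ⟨x₀, Function.update r k (rem (lev L k) L M x), ?_⟩
    have hk : pt L M x₀ (Function.update r k (rem (lev L k) L M x)) k = pt L M x₀ r k :=
      pt_congr L M x₀ k fun j hj => Function.update_of_ne (ne_of_lt hj) _ _
    show cpt (lev L k) L M (pt L M x₀ (Function.update r k (rem (lev L k) L M x)) k)
        + off (lev L k) L M (Function.update r k (rem (lev L k) L M x) k) = x
    rw [hk, h, Function.update_self, cpt_par_add_off_rem]

/-! ## §2 The readings of a class of coefficient towers -/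

/-- a UNIT-SCALE SITE of the readings: base point + address, 1-form component, direction, colour entry, real/imaginary part. [folklore] -/
structure Site (o : Type*) where
  /-- base point on the unit lattice -/
  base : Tor (fine (lev L 0) M)
  /-- block offsets at every level -/
  addr : ℕ → (Fin d → Fin L)
  /-- 1-form component -/
  cpn : Fin d
  /-- direction of the coefficient field -/
  dir : Fin d
  /-- colour row -/
  row : o
  /-- colour column -/
  col : o
  /-- real (`true`) or imaginary (`false`) part -/
  re : Bool

variable {o : Type*}

/-- the complex entry read at level `k`. [folklore] -/
def entryAt (W : (k : ℕ) → Fin d → (idx L M k → Matrix o o ℂ)) (k : ℕ) (s : Site L M o) : ℂ :=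
  W k s.dir (pt L M s.base s.addr k, s.cpn) s.row s.col

/-- **THE READINGS OF A CLASS `𝒟` OF COEFFICIENT TOWERS** (node U1b's `T4EtaRateMin.Readings`; scalar reading and volume unused).
[folklore] -/
def bgReadings (𝒟 : Set ((k : ℕ) → Fin d → (idx L M k → Matrix o o ℂ))) :
    Readings ((k : ℕ) → Fin d → (idx L M k → Matrix o o ℂ)) (Site L M o) where
  dom := 𝒟
  act := fun _ _ => 0
  loc := fun k W s => if s.re then (entryAt L M W k s).re else (entryAt L M W k s).im
  vol := 0
  vol_nonneg := le_rfl

/-! ## §3 `LocalRate` ⇔ two-level consistency -/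

section Edge

variable [Fintype o] [DecidableEq o]

omit [Fintype o] [DecidableEq o] in
/-- **NE3's currency ⇒ (H-cons)'s input, entrywise**: `LocalRate (bgReadings 𝒟) C θ` gives
`|(W (k+1) ν x′ − W k ν (parT x′)) a b| ≤ 2Cθ^k` for every tower of the class. [folklore] -/
theorem entry_consistent_of_localRate {𝒟 : Set ((k : ℕ) → Fin d → (idx L M k → Matrix o o ℂ))} {C θ : ℝ}
    (h : LocalRate (bgReadings L M 𝒟) C θ) {W : (k : ℕ) → Fin d → (idx L M k → Matrix o o ℂ)} (hW : W ∈ 𝒟) (k : ℕ) (ν : Fin d)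
    (x' : idx L M (k + 1)) (a b : o) : ‖(W (k + 1) ν x' - W k ν (parT (lev L k) L M x')) a b‖ ≤ 2 * (C * θ ^ k) := by
  obtain ⟨x₀, r, hx⟩ := exists_pt L M (k + 1) x'.1
  have hpar : (pt L M x₀ r k, x'.2) = parT (lev L k) L M x' := by
    rw [← par_pt_succ L M x₀ r k, hx]; rfl
  have hfine : (pt L M x₀ r (k + 1), x'.2) = x' := by rw [hx]
  have key : ∀ re : Bool, |(if re then (entryAt L M W (k + 1) ⟨x₀, r, x'.2, ν, a, b, re⟩).re
        else (entryAt L M W (k + 1) ⟨x₀, r, x'.2, ν, a, b, re⟩).im)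
        - (if re then (entryAt L M W k ⟨x₀, r, x'.2, ν, a, b, re⟩).re else (entryAt L M W k ⟨x₀, r, x'.2, ν, a, b, re⟩).im)|
        ≤ C * θ ^ k := fun re => h k W hW ⟨x₀, r, x'.2, ν, a, b, re⟩
  have hre := key true
  have him := key false
  simp only [if_true, Bool.false_eq_true, if_false, entryAt] at hre him
  rw [hfine, hpar, ← Complex.sub_re] at hre
  rw [hfine, hpar, ← Complex.sub_im] at him
  rw [Matrix.sub_apply]
  calc ‖W (k + 1) ν x' a b - W k ν (parT (lev L k) L M x') a b‖
      ≤ |(W (k + 1) ν x' a b - W k ν (parT (lev L k) L M x') a b).re| + |(W (k + 1) ν x' a b - W k ν (parT (lev L k) L M x') a b).im| :=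
        Complex.norm_le_abs_re_add_abs_im _
    _ ≤ C * θ ^ k + C * θ ^ k := add_le_add hre him
    _ = 2 * (C * θ ^ k) := by ring

/-- **NE3's currency ⇒ (H-cons)'s input, in operator norm**: `‖W (k+1) ν x′ − W k ν (parT x′)‖ ≤ 2·(card o)·C·θ^k`. [folklore] -/
theorem consistent_of_localRate {𝒟 : Set ((k : ℕ) → Fin d → (idx L M k → Matrix o o ℂ))} {C θ : ℝ} (hC : 0 ≤ C) (hθ : 0 ≤ θ)
    (h : LocalRate (bgReadings L M 𝒟) C θ) {W : (k : ℕ) → Fin d → (idx L M k → Matrix o o ℂ)} (hW : W ∈ 𝒟) (k : ℕ) (ν : Fin d)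
    (x' : idx L M (k + 1)) : ‖W (k + 1) ν x' - W k ν (parT (lev L k) L M x')‖ ≤ (Fintype.card o : ℝ) * (2 * (C * θ ^ k)) := by
  have hb : 0 ≤ 2 * (C * θ ^ k) := by positivity
  refine opNorm_le_of_schur _ (by positivity) (fun a => ?_) (fun b => ?_)
  · calc ∑ b, ‖(W (k + 1) ν x' - W k ν (parT (lev L k) L M x')) a b‖ ≤ ∑ _b : o, 2 * (C * θ ^ k) :=
          Finset.sum_le_sum fun b _ => entry_consistent_of_localRate L M h hW k ν x' a b
      _ = (Fintype.card o : ℝ) * (2 * (C * θ ^ k)) := by rw [Finset.sum_const, Finset.card_univ, nsmul_eq_mul]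
  · calc ∑ a, ‖(W (k + 1) ν x' - W k ν (parT (lev L k) L M x')) a b‖ ≤ ∑ _a : o, 2 * (C * θ ^ k) :=
          Finset.sum_le_sum fun a _ => entry_consistent_of_localRate L M h hW k ν x' a b
      _ = (Fintype.card o : ℝ) * (2 * (C * θ ^ k)) := by rw [Finset.sum_const, Finset.card_univ, nsmul_eq_mul]

/-- the same at `θ = L⁻¹`, in the currency of the `consistent` fields (`β/L^k` with `β = 2·card o·C`). [folklore] -/
theorem consistent_of_localRate_lev {𝒟 : Set ((k : ℕ) → Fin d → (idx L M k → Matrix o o ℂ))} {C : ℝ} (hC : 0 ≤ C)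
    (h : LocalRate (bgReadings L M 𝒟) C ((L : ℝ)⁻¹)) {W : (k : ℕ) → Fin d → (idx L M k → Matrix o o ℂ)} (hW : W ∈ 𝒟) (k : ℕ)
    (ν : Fin d) (x' : idx L M (k + 1)) :
    ‖W (k + 1) ν x' - W k ν (parT (lev L k) L M x')‖ ≤ (2 * (Fintype.card o : ℝ) * C) / (lev L k : ℕ) := by
  have hL : (0 : ℝ) ≤ (L : ℝ)⁻¹ := inv_nonneg.mpr (Nat.cast_nonneg L)
  refine (consistent_of_localRate L M hC hL h hW k ν x').trans (le_of_eq ?_)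
  rw [cast_lev', inv_pow, div_eq_mul_inv]; ring

/-- **THE CONVERSE** (the adapter is faithful): two-level consistency in operator norm with constant `β/L^k` gives
`LocalRate (bgReadings 𝒟) β L⁻¹`. [folklore] -/
theorem localRate_of_consistent {𝒟 : Set ((k : ℕ) → Fin d → (idx L M k → Matrix o o ℂ))} {β : ℝ}
    (h : ∀ W ∈ 𝒟, ∀ k ν (x' : idx L M (k + 1)), ‖W (k + 1) ν x' - W k ν (parT (lev L k) L M x')‖ ≤ β / (lev L k : ℕ)) :
    LocalRate (bgReadings L M 𝒟) β ((L : ℝ)⁻¹) := by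
  intro k W hW s
  have hx : parT (lev L k) L M ((pt L M s.base s.addr (k + 1), s.cpn) : idx L M (k + 1)) = ((pt L M s.base s.addr k, s.cpn) : idx L M k) := by
    show ((par (lev L k) L M (pt L M s.base s.addr (k + 1)), s.cpn) : idx L M k) = ((pt L M s.base s.addr k, s.cpn) : idx L M k)
    rw [par_pt_succ]
  have hmat := h W hW k s.dir ((pt L M s.base s.addr (k + 1), s.cpn) : idx L M (k + 1))
  rw [hx, cast_lev', div_eq_mul_inv, ← inv_pow] at hmat
  have hent : ‖entryAt L M W (k + 1) s - entryAt L M W k s‖ ≤ β * ((L : ℝ)⁻¹) ^ k := by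
    have e : entryAt L M W (k + 1) s - entryAt L M W k s
        = (W (k + 1) s.dir (pt L M s.base s.addr (k + 1), s.cpn) - W k s.dir (pt L M s.base s.addr k, s.cpn)) s.row s.col := by
      rw [Matrix.sub_apply]; rfl
    rw [e]; exact (norm_entry_le_opNorm _ _ _).trans hmat
  show |(if s.re then (entryAt L M W (k + 1) s).re else (entryAt L M W (k + 1) s).im)
      - (if s.re then (entryAt L M W k s).re else (entryAt L M W k s).im)| ≤ β * ((L : ℝ)⁻¹) ^ k
  cases s.re with
  | true =>
    simp only [if_true]
    rw [← Complex.sub_re]; exact (Complex.abs_re_le_norm _).trans hent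
  | false =>
    simp only [Bool.false_eq_true, if_false]
    rw [← Complex.sub_im]; exact (Complex.abs_im_le_norm _).trans hent

end Edge

end Summit.QuantumFields.BalabanUV.T4Continuum.NE2FromNE3

end
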